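import Mathlib
import Literature.MathematicalPhysics.QuantumFieldTheory.Balaban1983to89.B9
import Literature.MathematicalPhysics.QuantumFieldTheory.Balaban1983to89.B6RandomWalk

/-!
# `Balaban1983to89.B9Thm34Ext` — the Neumann-series step (3.62)–(3.65) behind Theorem 3.4 of B9, kernel-checked

T. Bałaban, *Propagators for lattice gauge theories in a background field*, Commun. Math. Phys. **99**, 389–434
(1985) [Balaban1985BackgroundPropagators] (cell paper B9; PDF held `paper:balaban1985-cmp99-background-propagators`,
journal page = PDF page + 388).  Sibling of `…Balaban1983to89.B9` (UNTOUCHED; its by-reference leaf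
`B9.SectBStepPrinted` — *"Thus Theorem 3.4 is proved, assuming that Theorems 3.1–3.3 hold"*, p. 407 — stays the
statement-level node; this module kernel-checks the FIRST of the inequalities that leaf quantifies over) and of
`…Balaban1983to89.B6RandomWalk` (unit pv08: the block-majorant calculus of [4] = [Balaban1984PropagatorsII]
(2.51)–(2.66), whose `HasMajorant`, `majorant_of_fixedPoint_266`, `majorant_pow_265` are REUSED through the
transport `toB6` below, not restated).

CITATION HEADER (lean-in-tree rule 2026-08-18).  This module is a KERNEL-CHECKED BOOKKEEPING STEP of the
published paper [Balaban1985BackgroundPropagators], Sect. A, pp. 402–403 [PDF 14–15], verbatim: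

> *"We assume that Theorem 3.1 is valid for the operator G′(U). The equality (3.60) can be written as
> Δ_{U′U} + Q′\*(U′U)aQ′(U′U) = (I − V′(A)G′(U))(Δ_U + Q′\*(U)aQ′(U)), (3.62) and the operator V′(A)G′(U)
> satisfies the bound |(V′(A)G′(U)λ)(x)| ≦ O(1)B₀α₁e^{−δ₀d(y,y′)} (3.63) for x ∈ Δ(y), supp λ ⊂ Δ(y′), or the
> bound |V′(A)G′(U)λ|_{(γ)} ≦ O(1)B₀α₁|λ|_{(γ)}.  Thus for α₁ sufficiently small the norm of this operator is small
> and I − V′(A)G′(U) is an invertible operator, the inverse is given by a convergent Neumann series.  This implies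
> the existence of the operator G′(U′U) and the equality G′(U′U) = G′(U)(I − V′(A)G′(U))^{−1} =
> Σ_{n=0}^∞ G′(U)(V′(A)G′(U))ⁿ. (3.64) … What is more important we have
> G′(U′U) = G′(U) + G′(U)V′(A)G′(U′U) = G′(U) + G′(U′U)V′(A)G′(U), (3.65) and norms of the second operators on
> the right-hand sides are small.  Now applying Theorem 3.1 for G′(U), the bound (3.63), the representation (3.64)
> and Lemma 2.1 of [4] we can prove all the statements (3.42)–(3.47) of Theorem 3.1 for the operator G′(U′U), of
> course with different constants, although changes are small."*

Here "Theorem 3.1 … for G′(U)" = (3.42) p. 397 [PDF 9] (*"|G′λ|, |∇_UG′λ|, … ≦ B₀[(L^jη)², L^jη, …]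
e^{−δ₀d(y,y′)}|λ| for x ∈ Δ(y), y ∈ Λ_j, supp λ ⊂ Δ(y′), y′ ∈ 𝔅"*; typed `B9.Ineq342_346_347`), "Lemma 2.1 of [4]" =
(2.60)–(2.63) of [Balaban1984PropagatorsII] p. 234 (typed `B6.Lemma21Printed`, `B6RandomWalk.Ineq261/B6RandomWalk.Ineq263`,
the *"hence"* (2.61) ⇒ (2.63) kernel-checked there as `B6RandomWalk.ineq263_of_261`), and the whole step is the one
the paper sums up on p. 407 [PDF 19]: *"Thus Theorem 3.4 is proved, assuming that Theorems 3.1–3.3 hold."*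
(Theorem 3.4, p. 400 [PDF 12], verbatim: *"There exists a positive constant a₁ such that the operators G′(U),
(Q′(U)G′²(U)Q′\*(U))^{−1}, R(U), G(U) extend to configurations U′U for α₁ ≦ a₁ as analytic functions of A. The
extended operators satisfy all the inequalities of Theorems 3.1–3.3 correspondingly."*)

WHAT IS REPRODUCED (0 sorry), for the FIRST entry of (3.42) (the sup bound |G′λ|; cell census row G-B9-02 had
certified the sup entries by hand, C-B9-1 — this is the kernel version with the constants the print leaves as
"different constants, although changes are small" made EXPLICIT):
* `toB6` — a B9 multiscale geometry (`B9.Geometry`: 𝔅, j, d(·,·), L, η, M of Sect. A p. 393/397) with a finite 𝔅 and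
  the parameter R of [4] (2.1)–(2.2) supplied IS a `B6.Geometry` (p. 393 [PDF 5], verbatim: *"The only change we make
  is that the sequence (2.1) starts with Ω₀ … The condition (2.2) is unchanged"*), so that [4]'s majorant calculus
  applies to B9's operators; the transport is the identity on 𝔅, j, d, L, η, M (`toB6_Site`, … by `rfl`).
* `neumannInverse_majorant` — **(3.64)**: if V′(A)G′(U) has the (3.63)-majorant θe^{−δ₀d(y,y′)} (θ = O(1)B₀α₁) and
  θc₁(α) < 1, the Neumann inverse S = (I − V′(A)G′(U))^{−1}, characterised by S = I + S·V′(A)G′(U), has majorant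
  c₁(α)(1 − θc₁(α))^{−1}e^{−(1−α)δ₀d(y,y′)} — *"for α₁ sufficiently small … the inverse is given by a convergent
  Neumann series"* with the smallness EXPLICIT: θc₁(α) < 1.
* `gpExt_entry1_of_365` — **(3.65) ⇒ (3.42)₁ for G′(U′U)**: if G′(U) has the (3.42)₁-majorant B₀(L^jη)²e^{−δ₀d(y,y′)}
  (more generally B₀P(y)e^{−δ₀d}, P ≥ 0 — so the same theorem serves any entry whose operator acts on site
  functions), V′(A)G′(U) has the (3.63)-majorant θe^{−δ₀d}, θc₁(α) < 1, and G′(U′U) satisfies the second identity of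
  (3.65), then |(G′(U′U)λ)(x)| ≦ B₀c₁(α)(1 − θc₁(α))^{−1}(L^jη)²e^{−(1−α)δ₀d(y,y′)}|λ| for x ∈ Δ(y), supp λ ⊂ Δ(y′):
  Theorem 3.1's first inequality for the extended operator with the "different constants" B₀ ↦ B₀c₁(α)/(1 − θc₁(α)),
  δ₀ ↦ (1 − α)δ₀ (any 0 < α < 1 for which (2.59) of [4] holds — *"changes are small"*: α ↓ 0 at the price of RM
  large).  This IS `B6RandomWalk.majorant_of_fixedPoint_266` ((2.66) of [4]: G′ = G′₀ + G′R) read through `toB6` —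
  the printed "using … Lemma 2.1 of [4]" is literally the [4] mechanism.
* `gpExt_entry1_explicit` — the threshold made a NUMBER: with θ = κ₀B₀α₁ (κ₀ = the O(1) of (3.63)) and
  α₁ ≦ a₁ := (2κ₀B₀c₁(α))^{−1} one has θc₁(α) ≦ ½ and the constant is ≦ 2B₀c₁(α) — a witness for Theorem 3.4's
  *"There exists a positive constant a₁"* on this entry, depending on d, L (through B₀, δ₀, c₁) only.
* `remainder_entry1` — p. 403 l. 1–9: *"the remainders … G′(U′U)V′(A)G′(U) in (3.65) … satisfy Theorem 3.1 with the
  additional small factor O(1)α₁"*, first entry: if G′(U′U) has majorant B₀′P(y)e^{−(1−α)δ₀d} (the previous bullet)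
  and V′(A)G′(U) the (3.63)-majorant θe^{−δ₀d}, then G′(U′U)V′(A)G′(U) has majorant
  B₀′c₁(α′; (1−α)δ₀)P(y)·θ·e^{−(1−α′)(1−α)δ₀d(y,y′)} — the "additional small factor" is θ = O(1)B₀α₁, and Lemma 2.1 is
  used once more, at the rate (1−α)δ₀ with an exponent α′ (c₁ evaluated there), so the rate drops a second time.

WHAT IS NOT REPRODUCED (hypotheses of the printed shape, each named — none is a cited fact; the paper is under
adjudication by the cell and is quoted, not cited, for them): (i) (3.63) itself (from (3.61) + (3.42): hypothesis
`h363`); (ii) the identity (3.65) / the existence of the inverse in (3.64) on the finite-dimensional function space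
(hypothesis `h365` / `hS`; on a finite lattice the Neumann series Σ(V′G′)ⁿ converges in operator norm once its
majorant series does — not re-derived here, the fixed-point identity is what the estimate consumes); (iii) the other
entries of (3.42)–(3.47) for G′(U′U) (the ∇_U-entry has the same proof with P(y) = L^jη once ∇_UG′ is viewed as an
operator into bond functions — pv08's calculus is typed for endomorphisms of ONE function space, so it is not
instantiated here; the Hölder entries (3.43)–(3.45) are the open part of G-B9-02; (3.47) follows from (3.42) by
Lemma 2.1 as on p. 398) and the Theorem 3.2/3.3 parts of Sect. B ((3.65)–(3.67), (3.86)); (iv) Lemma 2.1 of [4] for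
THIS geometry — entered as the (2.61)/(2.63)-shaped hypotheses `h261`, `h263` over `toB6 g R H` (by `ineq263_of_261`
the second follows from the first + the triangle inequality (2.54) + α ≤ 1, δ₀ ≥ 0 — `h263_of_h261`); (v) sign and
metric facts of the abstract carrier (d(y,y) = 0, d ≥ 0, (2.54)) — explicit hypotheses, as in `…B6RandomWalk`.
NOTHING of the series' end-statement (ultraviolet stability, [Balaban1987RG1] Thm 2 ff., under adjudication by the
cell `pub-balaban`) is asserted; value = kernel-checked bookkeeping of a printed "we can prove", NOT summit progress.
Unit `b2b-balaban-b09-g2` (paper sub-cell B09, gen 2), SHARPEN pass 2 of node T06.4; cell rows C-B9-15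
(certification), G-B9-02 (narrowed to the Hölder entries).
-/

namespace Literature.MathematicalPhysics.QuantumFieldTheory.Balaban1983to89.B9Thm34Ext

open Literature.MathematicalPhysics.QuantumFieldTheory.Balaban1983to89

/-! ## The transport B9 geometry ↦ B6 geometry (p. 393: "The only change we make is that the sequence (2.1) starts
with Ω₀ … The condition (2.2) is unchanged") -/

/-- A B9 multiscale geometry with finite 𝔅 (`[Fintype g.Site]`), together with the parameter R of [4] (2.1)–(2.2) and
the Prop recording (2.1)–(2.2) for it, read as a `B6.Geometry`: identity on 𝔅, j, d, k, η, L, M and on the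
localisation/cut-off sorts (B9's Δ(y)-support predicates `suppIn`, `cutIn` are the ones [4] uses: Δ(y) = B^j(y)).
Nothing is asserted: `H2122` is a parameter. [cite: Balaban1985BackgroundPropagators, Sect. A p.393 + (3.41) p.397] -/
def toB6 (g : B9.Geometry) [Fintype g.Site] (R : ℝ) (H2122 : Prop) : B6.Geometry where
  Site := g.Site
  fin := inferInstance
  scale := g.scale
  dist := g.dist
  k := g.k
  eta := g.eta
  L := g.L
  R := R
  M := g.M
  Hyp21_22 := H2122
  Loc := g.Loc
  suppIn := g.suppIn
  supNorm := g.supNorm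
  l2Norm := g.l2Norm
  holder := g.holder
  Cut := g.Cut
  cutIn := g.cutIn
  cutH := g.cutH
  cutSup := g.cutSup

section Transport

variable (g : B9.Geometry) [Fintype g.Site] (R : ℝ) (H : Prop)

/-- The transport is the identity on 𝔅. [folklore] -/
@[simp] theorem toB6_Site : (toB6 g R H).Site = g.Site := rfl

/-- The transport is the identity on j. [folklore] -/
@[simp] theorem toB6_scale : (toB6 g R H).scale = g.scale := rfl

/-- The transport is the identity on d(·,·). [folklore] -/
@[simp] theorem toB6_dist : (toB6 g R H).dist = g.dist := rfl

/-- The transport is the identity on η. [folklore] -/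
@[simp] theorem toB6_eta : (toB6 g R H).eta = g.eta := rfl

/-- The transport is the identity on L. [folklore] -/
@[simp] theorem toB6_L : (toB6 g R H).L = g.L := rfl

/-- The transport is the identity on M. [folklore] -/
@[simp] theorem toB6_M : (toB6 g R H).M = g.M := rfl

/-- The transport is the identity on R. [folklore] -/
@[simp] theorem toB6_R : (toB6 g R H).R = R := rfl

/-- The transport is the identity on k. [folklore] -/
@[simp] theorem toB6_k : (toB6 g R H).k = g.k := rfl


/-- The transported scale length is B9's L^jη (3.41). [cite: Balaban1985BackgroundPropagators, (3.41) p.397] -/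
theorem toB6_len (y : g.Site) : (toB6 g R H).L ^ (toB6 g R H).scale y * (toB6 g R H).eta = g.len y := rfl

/-- (2.61) of [4] for the transported geometry IS the row-sum bound over B9's 𝔅 with B9's distance (by `Iff.rfl`).
[cite: Balaban1984PropagatorsII, (2.61) p.234] -/
theorem ineq261_toB6_iff (d : ℕ) (δ₀ α : ℝ) :
    B6RandomWalk.Ineq261 d (toB6 g R H) δ₀ α ↔
      ∀ y : g.Site, ∑ y' : g.Site, Real.exp (-(α * δ₀ * g.dist y y')) ≤ B6.c1 d δ₀ α :=
  Iff.rfl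

/-- (2.54) of [4] for the transported geometry IS the triangle inequality of B9's d (by `Iff.rfl`).
[cite: Balaban1984PropagatorsII, (2.54) p.233] -/
theorem triangle254_toB6_iff : B6RandomWalk.Triangle254 (toB6 g R H) ↔ ∀ a b c : g.Site, g.dist a c ≤ g.dist a b + g.dist b c :=
  Iff.rfl

/-- (2.63) for the transported geometry from (2.61) + (2.54), α ≤ 1, δ₀ ≥ 0 — pv08's `ineq263_of_261` read through
`toB6`. [cite: Balaban1984PropagatorsII, Lemma 2.1 p.234] -/
theorem h263_of_h261 (d : ℕ) (δ₀ α : ℝ) (htri : B6RandomWalk.Triangle254 (toB6 g R H)) (hδ : 0 ≤ δ₀) (hα : α ≤ 1)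
    (h261 : B6RandomWalk.Ineq261 d (toB6 g R H) δ₀ α) : B6RandomWalk.Ineq263 d (toB6 g R H) δ₀ α :=
  B6RandomWalk.ineq263_of_261 d (toB6 g R H) δ₀ α htri hδ hα h261

end Transport

/-! ## (3.63)–(3.65): the Neumann series in the majorant calculus of [4] -/

section Neumann

variable {g : B9.Geometry} [Fintype g.Site] {R : ℝ} {H : Prop} {X : Type} [Fintype X] [DecidableEq X]

omit [Fintype X] [DecidableEq X] in
/-- The identity operator has the majorant 1·e^{−δ₀d(y,y′)} in the sense of (2.51)/(2.64) of [4] (uses d(y,y) = 0,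
(2.46)): the n = 0 term of the Neumann series (3.64). [cite: Balaban1985BackgroundPropagators, (3.64) p.402] -/
theorem hasMajorant_one (blk : X → g.Site) (δ₀ : ℝ) (hrefl : ∀ y : g.Site, g.dist y y = 0) :
    B6RandomWalk.HasMajorant (g := toB6 g R H) blk (1 : Module.End ℝ (X → ℝ))
      (fun a b => 1 * 1 * Real.exp (-(δ₀ * g.dist a b))) := by
  intro y' μ B hμ x
  by_cases hx : blk x = y'
  · have h1 : Real.exp (-(δ₀ * g.dist (blk x) y')) = 1 := by rw [hx, hrefl y']; simp
    simp only [Module.End.one_apply, one_mul]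
    rw [h1, one_mul]
    exact hμ.bound x hx
  · simp only [Module.End.one_apply, hμ.off x hx, abs_zero, one_mul]
    exact mul_nonneg (Real.exp_nonneg _) hμ.nonneg

/-- **(3.64), the inverse by a convergent Neumann series — with the smallness explicit.**  If the operator
V = V′(A)G′(U) has the (3.63)-majorant θe^{−δ₀d(y,y′)} (θ = O(1)B₀α₁ ≥ 0), Lemma 2.1 of [4] holds for the geometry at
the exponent α ((2.61); (2.63) follows, `h263_of_h261`) and θc₁(α) < 1 (*"for α₁ sufficiently small the norm of this
operator is small"*), then the operator S with S = I + S·V — the Neumann inverse (I − V)^{−1} = Σ_{n≥0}Vⁿ of (3.64) —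
has majorant c₁(α)(1 − θc₁(α))^{−1}e^{−(1−α)δ₀d(y,y′)}.  Instance of [4] (2.66) (`B6RandomWalk.majorant_of_fixedPoint_266`
with G′₀ = I). [cite: Balaban1985BackgroundPropagators, (3.63)–(3.64) p.402] -/
theorem neumannInverse_majorant (blk : X → g.Site) (d : ℕ) (δ₀ α θ : ℝ) (hθ : 0 ≤ θ)
    (hαδ : 0 ≤ (1 - α) * δ₀) (htri : B6RandomWalk.Triangle254 (toB6 g R H)) (hrefl : ∀ y : g.Site, g.dist y y = 0)
    (hdnn : ∀ y y' : g.Site, 0 ≤ g.dist y y') (h261 : B6RandomWalk.Ineq261 d (toB6 g R H) δ₀ α)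
    (h263 : B6RandomWalk.Ineq263 d (toB6 g R H) δ₀ α) (hsmall : θ * B6.c1 d δ₀ α < 1)
    {S V : Module.End ℝ (X → ℝ)}
    (h363 : B6RandomWalk.HasMajorant (g := toB6 g R H) blk V (fun a b => θ * Real.exp (-(δ₀ * g.dist a b))))
    (hS : S = 1 + S * V) :
    B6RandomWalk.HasMajorant (g := toB6 g R H) blk S
      (fun a b => B6.c1 d δ₀ α * (1 - θ * B6.c1 d δ₀ α)⁻¹ * Real.exp (-((1 - α) * δ₀ * g.dist a b))) := by
  have h := B6RandomWalk.majorant_of_fixedPoint_266 (g := toB6 g R H) blk d δ₀ α θ 1 (fun _ => (1 : ℝ))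
    zero_le_one (fun _ => zero_le_one) hθ hαδ htri hrefl hdnn h261 h263 hsmall
    (hasMajorant_one (R := R) (H := H) blk δ₀ hrefl) h363 hS
  refine B6RandomWalk.hasMajorant_mono (g := toB6 g R H) blk h fun a b => le_of_eq ?_
  simp only [toB6_dist]
  ring

/-- **(3.65) ⇒ Theorem 3.1's first inequality for G′(U′U), constants explicit.**  Hypotheses, all of the printed
shape: `h342` = (3.42)₁ for G′(U) as a (2.51)-majorant B₀P(y)e^{−δ₀d(y,y′)} with P(y) = (L^jη)² (any P ≥ 0 allowed);
`h363` = (3.63); `h365` = the second identity of (3.65), G′(U′U) = G′(U) + G′(U′U)V′(A)G′(U); Lemma 2.1 of [4] at the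
exponent α; the smallness θc₁(α) < 1.  Conclusion: |(G′(U′U)λ)(x)| ≦ B₀c₁(α)(1 − θc₁(α))^{−1}P(y)e^{−(1−α)δ₀d(y,y′)}|λ|
for x ∈ Δ(y), supp λ ⊂ Δ(y′) — *"all the statements (3.42)–(3.47) … for the operator G′(U′U), of course with
different constants, although changes are small"*, first statement, with the different constants NAMED.  This is
[4] (2.66) (`B6RandomWalk.majorant_of_fixedPoint_266`) read through `toB6`.
[cite: Balaban1985BackgroundPropagators, (3.62)–(3.65) pp.402–403] -/
theorem gpExt_entry1_of_365 (blk : X → g.Site) (d : ℕ) (δ₀ α θ B₀ : ℝ) (P : g.Site → ℝ)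
    (hB₀ : 0 ≤ B₀) (hP : ∀ y, 0 ≤ P y) (hθ : 0 ≤ θ) (hαδ : 0 ≤ (1 - α) * δ₀)
    (htri : B6RandomWalk.Triangle254 (toB6 g R H)) (hrefl : ∀ y : g.Site, g.dist y y = 0)
    (hdnn : ∀ y y' : g.Site, 0 ≤ g.dist y y') (h261 : B6RandomWalk.Ineq261 d (toB6 g R H) δ₀ α)
    (h263 : B6RandomWalk.Ineq263 d (toB6 g R H) δ₀ α) (hsmall : θ * B6.c1 d δ₀ α < 1)
    {GpU GpExt V : Module.End ℝ (X → ℝ)}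
    (h342 : B6RandomWalk.HasMajorant (g := toB6 g R H) blk GpU (fun a b => B₀ * P a * Real.exp (-(δ₀ * g.dist a b))))
    (h363 : B6RandomWalk.HasMajorant (g := toB6 g R H) blk V (fun a b => θ * Real.exp (-(δ₀ * g.dist a b))))
    (h365 : GpExt = GpU + GpExt * V) :
    B6RandomWalk.HasMajorant (g := toB6 g R H) blk GpExt
      (fun a b => B₀ * B6.c1 d δ₀ α * (1 - θ * B6.c1 d δ₀ α)⁻¹ * P a *
        Real.exp (-((1 - α) * δ₀ * g.dist a b))) :=
  B6RandomWalk.majorant_of_fixedPoint_266 (g := toB6 g R H) blk d δ₀ α θ B₀ P hB₀ hP hθ hαδ htri hrefl hdnn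
    h261 h263 hsmall h342 h363 h365

/-- **Theorem 3.4's "positive constant a₁", witnessed on this entry.**  With θ = κ₀B₀α₁ (κ₀ > 0 the O(1) of (3.63),
B₀ > 0 of Theorem 3.1) and the EXPLICIT threshold α₁ ≦ a₁ := (2κ₀B₀c₁(α))^{−1}: θc₁(α) ≦ ½, and G′(U′U) obeys
(3.42)₁ with constant 2B₀c₁(α) and rate (1−α)δ₀ — a₁ depends on d, L (via B₀, δ₀, c₁(α) = 12c₀(½α)^d of [4] (2.61))
only, as Theorem 3.4 asserts. [cite: Balaban1985BackgroundPropagators, Thm 3.4 p.400 + (3.62)–(3.65) pp.402–403] -/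
theorem gpExt_entry1_explicit (blk : X → g.Site) (d : ℕ) (δ₀ α κ₀ B₀ α₁ : ℝ) (P : g.Site → ℝ)
    (hB₀ : 0 < B₀) (hκ₀ : 0 < κ₀) (hα₁ : 0 ≤ α₁) (hP : ∀ y, 0 ≤ P y) (hαδ : 0 ≤ (1 - α) * δ₀)
    (hc₁ : 0 < B6.c1 d δ₀ α)
    (htri : B6RandomWalk.Triangle254 (toB6 g R H)) (hrefl : ∀ y : g.Site, g.dist y y = 0)
    (hdnn : ∀ y y' : g.Site, 0 ≤ g.dist y y') (h261 : B6RandomWalk.Ineq261 d (toB6 g R H) δ₀ α)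
    (h263 : B6RandomWalk.Ineq263 d (toB6 g R H) δ₀ α)
    (ha₁ : α₁ ≤ (2 * κ₀ * B₀ * B6.c1 d δ₀ α)⁻¹)
    {GpU GpExt V : Module.End ℝ (X → ℝ)}
    (h342 : B6RandomWalk.HasMajorant (g := toB6 g R H) blk GpU (fun a b => B₀ * P a * Real.exp (-(δ₀ * g.dist a b))))
    (h363 : B6RandomWalk.HasMajorant (g := toB6 g R H) blk V
      (fun a b => κ₀ * B₀ * α₁ * Real.exp (-(δ₀ * g.dist a b))))
    (h365 : GpExt = GpU + GpExt * V) :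
    B6RandomWalk.HasMajorant (g := toB6 g R H) blk GpExt
      (fun a b => 2 * B₀ * B6.c1 d δ₀ α * P a * Real.exp (-((1 - α) * δ₀ * g.dist a b))) := by
  set θ : ℝ := κ₀ * B₀ * α₁ with hθdef
  set c : ℝ := B6.c1 d δ₀ α with hcdef
  have hθ : 0 ≤ θ := by positivity
  have hprod : 0 < 2 * κ₀ * B₀ * c := by positivity
  -- θ c ≤ 1/2 from α₁ ≤ (2 κ₀ B₀ c)⁻¹
  have hθc : θ * c ≤ 1 / 2 := by
    have h1 : α₁ * (2 * κ₀ * B₀ * c) ≤ 1 := by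
      have := mul_le_mul_of_nonneg_right ha₁ hprod.le
      rwa [inv_mul_cancel₀ hprod.ne'] at this
    have : θ * c = α₁ * (2 * κ₀ * B₀ * c) / 2 := by rw [hθdef]; ring
    rw [this]
    linarith
  have hsmall : θ * c < 1 := by linarith
  have hinv : (1 - θ * c)⁻¹ ≤ 2 := by
    rw [inv_le_comm₀ (by linarith) (by norm_num : (0 : ℝ) < 2)]
    linarith
  have h := gpExt_entry1_of_365 (R := R) (H := H) blk d δ₀ α θ B₀ P hB₀.le hP hθ hαδ htri hrefl hdnn h261 h263
    hsmall h342 h363 h365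
  refine B6RandomWalk.hasMajorant_mono (g := toB6 g R H) blk h fun a b => ?_
  have hPa := hP a
  have hE : 0 ≤ Real.exp (-((1 - α) * δ₀ * g.dist a b)) := Real.exp_nonneg _
  have : B₀ * c * (1 - θ * c)⁻¹ ≤ 2 * B₀ * c := by
    calc B₀ * c * (1 - θ * c)⁻¹ ≤ B₀ * c * 2 :=
          mul_le_mul_of_nonneg_left hinv (mul_nonneg hB₀.le hc₁.le)
      _ = 2 * B₀ * c := by ring
  calc B₀ * c * (1 - θ * c)⁻¹ * P a * Real.exp (-((1 - α) * δ₀ * g.dist a b))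
      ≤ 2 * B₀ * c * P a * Real.exp (-((1 - α) * δ₀ * g.dist a b)) := by
        apply mul_le_mul_of_nonneg_right _ hE
        exact mul_le_mul_of_nonneg_right this hPa
    _ = _ := by rfl

omit [Fintype X] [DecidableEq X] in
/-- **The remainder in (3.65), first entry** (p. 403 [PDF 15] l. 1–9, verbatim: *"This allows us to formulate a
statement concerning the remainders G′(U)V′(A)G′(U′U) and G′(U′U)V′(A)G′(U) in (3.65). They satisfy Theorem 3.1 with
the additional small factor O(1)α₁."*): from the G′(U′U)-majorant just obtained (constant B₀′, rate (1−α)δ₀) and the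
(3.63)-majorant of V′(A)G′(U), weakened θe^{−δ₀d} ≤ θe^{−(1−α′)(1−α)δ₀d} (needs αδ₀, α′, (1−α)δ₀, d ≥ 0), the
product G′(U′U)·V′(A)G′(U) has majorant B₀′·θ·c₁′·P(y)e^{−(1−α′)(1−α)δ₀d(y,y′)} by ONE more use of Lemma 2.1, now at
the rate (1−α)δ₀ with exponent α′ ((2.61) at (α′, (1−α)δ₀): hypothesis `h261'`) — the "additional small factor" is
θ = O(1)B₀α₁ and the rate drops once more, (1−α)δ₀ ↦ (1−α′)(1−α)δ₀.  Mechanism: pv08's `majorant_G0_mul_265`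
((2.66) of [4], one term) read through `toB6`. [cite: Balaban1985BackgroundPropagators, (3.65) p.402 + p.403 l.1–9] -/
theorem remainder_entry1 (blk : X → g.Site) (d : ℕ) (δ₀ α α' θ B₀' : ℝ) (P : g.Site → ℝ)
    (hB₀' : 0 ≤ B₀') (hP : ∀ y, 0 ≤ P y) (hθ : 0 ≤ θ) (hαδ : 0 ≤ α * δ₀) (h1αδ : 0 ≤ (1 - α) * δ₀)
    (hα' : 0 ≤ α') (hα'δ : 0 ≤ (1 - α') * ((1 - α) * δ₀))
    (htri : B6RandomWalk.Triangle254 (toB6 g R H)) (hdnn : ∀ y y' : g.Site, 0 ≤ g.dist y y')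
    (h261' : B6RandomWalk.Ineq261 d (toB6 g R H) ((1 - α) * δ₀) α')
    {GpExt V : Module.End ℝ (X → ℝ)}
    (hExt : B6RandomWalk.HasMajorant (g := toB6 g R H) blk GpExt
      (fun a b => B₀' * P a * Real.exp (-((1 - α) * δ₀ * g.dist a b))))
    (h363 : B6RandomWalk.HasMajorant (g := toB6 g R H) blk V (fun a b => θ * Real.exp (-(δ₀ * g.dist a b)))) :
    B6RandomWalk.HasMajorant (g := toB6 g R H) blk (GpExt * V)
      (fun a b => B₀' * B6.c1 d ((1 - α) * δ₀) α' * P a * θ *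
        Real.exp (-((1 - α') * ((1 - α) * δ₀) * g.dist a b))) := by
  -- weaken the rate of V's majorant: e^{−δ₀d} ≤ e^{−(1−α')(1−α)δ₀ d}
  have hV : B6RandomWalk.HasMajorant (g := toB6 g R H) blk V
      (fun a b => θ * Real.exp (-((1 - α') * ((1 - α) * δ₀) * g.dist a b))) := by
    refine B6RandomWalk.hasMajorant_mono (g := toB6 g R H) blk h363 fun a b => ?_
    refine mul_le_mul_of_nonneg_left (Real.exp_le_exp.mpr ?_) hθ
    have hd := hdnn a b
    -- δ₀d − (1−α')(1−α)δ₀d = αδ₀d + α'(1−α)δ₀d ≥ 0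
    have h1 : 0 ≤ α * δ₀ * g.dist a b := mul_nonneg hαδ hd
    have h3 : 0 ≤ α' * ((1 - α) * δ₀ * g.dist a b) := mul_nonneg hα' (mul_nonneg h1αδ hd)
    have key : δ₀ * g.dist a b - (1 - α') * ((1 - α) * δ₀) * g.dist a b =
        α * δ₀ * g.dist a b + α' * ((1 - α) * δ₀ * g.dist a b) := by ring
    linarith [h1, h3, key]
  have h := B6RandomWalk.majorant_G0_mul_265 (g := toB6 g R H) blk d ((1 - α) * δ₀) α' B₀' θ P hB₀' hP hθ hα'δ
    htri h261' hExt hV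
  exact B6RandomWalk.hasMajorant_mono (g := toB6 g R H) blk h fun a b => le_of_eq rfl

end Neumann

end Literature.MathematicalPhysics.QuantumFieldTheory.Balaban1983to89.B9Thm34Ext
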